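import Summits.Ventures.CertifiedManyBodySolver.Downfold.EmeryFermiScaleFaceCCertD
import HarnessLib

/-!
# The certificate of the ANTINODAL SCALE LEVER for general `t_pp′`, part E (the ASSEMBLED 2016-term polynomial `scaleFaceCCert` = strict term + parts 1–72, and its positivity `scaleFaceCCert_pos`)

Venture CertifiedManyBodySolver, cell `pub/hubbard-downfold` (stage S1; INFLATION-RULES-3to1-B §B.74 (b″)), seat hubbard-downfold-mod-4 (technique B, g30); namespace
`Summit.Ventures.CertifiedManyBodySolver.Downfold.Emery`. Object: `scaleFaceCCert Δ ε₁ d c h m Q G₁ G₂ P` (assembled in the last part): 2016 products `λ·Δ^i ε₁^j d^k c^l h^n m^r·{1, Q, G₁, G₂, P,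
degree ≤ 2}` with positive INTEGER weights (`L = 1000000` times rationals of denominator dividing `10⁶`), where in the sequel `c = t_pp′`, `h = t_pp − t_pp′`, `m = t_pd² − t_pp′ε₂`, `d = ε₂ − ε₁`,
`Q = 4t_pd² − t_ppΔ`, `G₁ = faceG(ε₁)`, `G₂ = (8fsD + 16fsN − cA)(ε₂)`, `P = t_pd² − t_pp²`; it satisfies `L·(scaleFaceN(ε₁)scaleFaceD(ε₂) − scaleFaceN(ε₂)scaleFaceD(ε₁)) =
d·scaleFaceCCert` with `t_pp = c + h` (`EmeryFermiScaleFaceCLever.scaleFaceC_cross_eq`). FOUND by linear programming (kit jobs j339646/j339688/j339693 of this seat: Handelman basis of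
degree ≤ 2 in the four atoms — feasible once `t_pd²` is eliminated by `t_pd² = t_pp′ε₂ + m` and the regime atom `P` is added; pure-monomial columns explicit; INTERIOR ROUNDING: a uniform
residual margin maximised over the pooled bracket supports, bracket weights rounded to denominator 10⁶, unit-monomial weights = the exact residuals) and CHECKED here by `positivity`
(parts) and in the sequel by `ring` (identity) — nothing trusts the search. Everything PROVED (0 sorry). WHAT THIS IS NOT: a statement about any material; an object with physical meaning
by itself (the meaning is in `EmeryFermiScaleHarmonic`: convexity of the Γ offset plus a shape term).

Sources: polynomial positivity certificates on semialgebraic sets [folklore] (Handelman, Pacific J. Math. 132 (1988) 35–62).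
-/

noncomputable section

namespace Summit.Ventures.CertifiedManyBodySolver.Downfold.Emery

open Real Set


/-- **The certificate polynomial `scaleFaceCCert`** (general `t_pp′`; 2016 products with positive INTEGER weights, `L = 1000000`; atoms `Q, G₁, G₂, P`; strict term
`66867560·Δ ^ 2 * ε₁ ^ 2 * d ^ 2 * m ^ 2` first; 72 parts). [folklore] -/
def scaleFaceCCert (Δ ε₁ d c h m Q G₁ G₂ P : ℝ) : ℝ :=
  66867560 * Δ ^ 2 * ε₁ ^ 2 * d ^ 2 * m ^ 2 +
    scaleFaceCCertP1 Δ ε₁ d c h m Q G₁ G₂ P +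
    scaleFaceCCertP2 Δ ε₁ d c h m Q G₁ G₂ P +
    scaleFaceCCertP3 Δ ε₁ d c h m Q G₁ G₂ P +
    scaleFaceCCertP4 Δ ε₁ d c h m Q G₁ G₂ P +
    scaleFaceCCertP5 Δ ε₁ d c h m Q G₁ G₂ P +
    scaleFaceCCertP6 Δ ε₁ d c h m Q G₁ G₂ P +
    scaleFaceCCertP7 Δ ε₁ d c h m Q G₁ G₂ P +
    scaleFaceCCertP8 Δ ε₁ d c h m Q G₁ G₂ P +
    scaleFaceCCertP9 Δ ε₁ d c h m Q G₁ G₂ P +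
    scaleFaceCCertP10 Δ ε₁ d c h m Q G₁ G₂ P +
    scaleFaceCCertP11 Δ ε₁ d c h m Q G₁ G₂ P +
    scaleFaceCCertP12 Δ ε₁ d c h m Q G₁ G₂ P +
    scaleFaceCCertP13 Δ ε₁ d c h m Q G₁ G₂ P +
    scaleFaceCCertP14 Δ ε₁ d c h m Q G₁ G₂ P +
    scaleFaceCCertP15 Δ ε₁ d c h m Q G₁ G₂ P +
    scaleFaceCCertP16 Δ ε₁ d c h m Q G₁ G₂ P +
    scaleFaceCCertP17 Δ ε₁ d c h m Q G₁ G₂ P +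
    scaleFaceCCertP18 Δ ε₁ d c h m Q G₁ G₂ P +
    scaleFaceCCertP19 Δ ε₁ d c h m Q G₁ G₂ P +
    scaleFaceCCertP20 Δ ε₁ d c h m Q G₁ G₂ P +
    scaleFaceCCertP21 Δ ε₁ d c h m Q G₁ G₂ P +
    scaleFaceCCertP22 Δ ε₁ d c h m Q G₁ G₂ P +
    scaleFaceCCertP23 Δ ε₁ d c h m Q G₁ G₂ P +
    scaleFaceCCertP24 Δ ε₁ d c h m Q G₁ G₂ P +
    scaleFaceCCertP25 Δ ε₁ d c h m Q G₁ G₂ P +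
    scaleFaceCCertP26 Δ ε₁ d c h m Q G₁ G₂ P +
    scaleFaceCCertP27 Δ ε₁ d c h m Q G₁ G₂ P +
    scaleFaceCCertP28 Δ ε₁ d c h m Q G₁ G₂ P +
    scaleFaceCCertP29 Δ ε₁ d c h m Q G₁ G₂ P +
    scaleFaceCCertP30 Δ ε₁ d c h m Q G₁ G₂ P +
    scaleFaceCCertP31 Δ ε₁ d c h m Q G₁ G₂ P +
    scaleFaceCCertP32 Δ ε₁ d c h m Q G₁ G₂ P +
    scaleFaceCCertP33 Δ ε₁ d c h m Q G₁ G₂ P +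
    scaleFaceCCertP34 Δ ε₁ d c h m Q G₁ G₂ P +
    scaleFaceCCertP35 Δ ε₁ d c h m Q G₁ G₂ P +
    scaleFaceCCertP36 Δ ε₁ d c h m Q G₁ G₂ P +
    scaleFaceCCertP37 Δ ε₁ d c h m Q G₁ G₂ P +
    scaleFaceCCertP38 Δ ε₁ d c h m Q G₁ G₂ P +
    scaleFaceCCertP39 Δ ε₁ d c h m Q G₁ G₂ P +
    scaleFaceCCertP40 Δ ε₁ d c h m Q G₁ G₂ P +
    scaleFaceCCertP41 Δ ε₁ d c h m Q G₁ G₂ P +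
    scaleFaceCCertP42 Δ ε₁ d c h m Q G₁ G₂ P +
    scaleFaceCCertP43 Δ ε₁ d c h m Q G₁ G₂ P +
    scaleFaceCCertP44 Δ ε₁ d c h m Q G₁ G₂ P +
    scaleFaceCCertP45 Δ ε₁ d c h m Q G₁ G₂ P +
    scaleFaceCCertP46 Δ ε₁ d c h m Q G₁ G₂ P +
    scaleFaceCCertP47 Δ ε₁ d c h m Q G₁ G₂ P +
    scaleFaceCCertP48 Δ ε₁ d c h m Q G₁ G₂ P +
    scaleFaceCCertP49 Δ ε₁ d c h m Q G₁ G₂ P +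
    scaleFaceCCertP50 Δ ε₁ d c h m Q G₁ G₂ P +
    scaleFaceCCertP51 Δ ε₁ d c h m Q G₁ G₂ P +
    scaleFaceCCertP52 Δ ε₁ d c h m Q G₁ G₂ P +
    scaleFaceCCertP53 Δ ε₁ d c h m Q G₁ G₂ P +
    scaleFaceCCertP54 Δ ε₁ d c h m Q G₁ G₂ P +
    scaleFaceCCertP55 Δ ε₁ d c h m Q G₁ G₂ P +
    scaleFaceCCertP56 Δ ε₁ d c h m Q G₁ G₂ P +
    scaleFaceCCertP57 Δ ε₁ d c h m Q G₁ G₂ P +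
    scaleFaceCCertP58 Δ ε₁ d c h m Q G₁ G₂ P +
    scaleFaceCCertP59 Δ ε₁ d c h m Q G₁ G₂ P +
    scaleFaceCCertP60 Δ ε₁ d c h m Q G₁ G₂ P +
    scaleFaceCCertP61 Δ ε₁ d c h m Q G₁ G₂ P +
    scaleFaceCCertP62 Δ ε₁ d c h m Q G₁ G₂ P +
    scaleFaceCCertP63 Δ ε₁ d c h m Q G₁ G₂ P +
    scaleFaceCCertP64 Δ ε₁ d c h m Q G₁ G₂ P +
    scaleFaceCCertP65 Δ ε₁ d c h m Q G₁ G₂ P +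
    scaleFaceCCertP66 Δ ε₁ d c h m Q G₁ G₂ P +
    scaleFaceCCertP67 Δ ε₁ d c h m Q G₁ G₂ P +
    scaleFaceCCertP68 Δ ε₁ d c h m Q G₁ G₂ P +
    scaleFaceCCertP69 Δ ε₁ d c h m Q G₁ G₂ P +
    scaleFaceCCertP70 Δ ε₁ d c h m Q G₁ G₂ P +
    scaleFaceCCertP71 Δ ε₁ d c h m Q G₁ G₂ P +
    scaleFaceCCertP72 Δ ε₁ d c h m Q G₁ G₂ P

/-- `scaleFaceCCert > 0` for `Δ, ε₁, d, m > 0` and all other arguments `≥ 0`. [folklore] -/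
theorem scaleFaceCCert_pos {Δ ε₁ d c h m Q G₁ G₂ P : ℝ} (hΔ : 0 < Δ) (h1 : 0 < ε₁) (hd : 0 < d) (hc : 0 ≤ c) (hh : 0 ≤ h) (hm : 0 < m) (hQ : 0 ≤ Q) (hG₁ : 0 ≤ G₁) (hG₂ : 0 ≤ G₂) (hP : 0 ≤ P) :
    0 < scaleFaceCCert Δ ε₁ d c h m Q G₁ G₂ P := by
  have p1 : 0 ≤ scaleFaceCCertP1 Δ ε₁ d c h m Q G₁ G₂ P := scaleFaceCCertP1_nonneg (hΔ := hΔ.le) (h1 := h1.le) (hd := hd.le) (hc := hc) (hh := hh) (hQ := hQ)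
  have p2 : 0 ≤ scaleFaceCCertP2 Δ ε₁ d c h m Q G₁ G₂ P := scaleFaceCCertP2_nonneg (hΔ := hΔ.le) (h1 := h1.le) (hd := hd.le) (hc := hc) (hh := hh) (hQ := hQ) (hG₁ := hG₁)
  have p3 : 0 ≤ scaleFaceCCertP3 Δ ε₁ d c h m Q G₁ G₂ P := scaleFaceCCertP3_nonneg (hΔ := hΔ.le) (h1 := h1.le) (hd := hd.le) (hc := hc) (hh := hh) (hm := hm.le) (hG₁ := hG₁) (hG₂ := hG₂)
  have p4 : 0 ≤ scaleFaceCCertP4 Δ ε₁ d c h m Q G₁ G₂ P := scaleFaceCCertP4_nonneg (hΔ := hΔ.le) (h1 := h1.le) (hd := hd.le) (hc := hc) (hh := hh) (hG₂ := hG₂)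
  have p5 : 0 ≤ scaleFaceCCertP5 Δ ε₁ d c h m Q G₁ G₂ P := scaleFaceCCertP5_nonneg (hΔ := hΔ.le) (h1 := h1.le) (hd := hd.le) (hc := hc) (hh := hh) (hG₂ := hG₂) (hP := hP)
  have p6 : 0 ≤ scaleFaceCCertP6 Δ ε₁ d c h m Q G₁ G₂ P := scaleFaceCCertP6_nonneg (hΔ := hΔ.le) (h1 := h1.le) (hd := hd.le) (hc := hc) (hh := hh) (hP := hP)
  have p7 : 0 ≤ scaleFaceCCertP7 Δ ε₁ d c h m Q G₁ G₂ P := scaleFaceCCertP7_nonneg (hΔ := hΔ.le) (h1 := h1.le) (hd := hd.le) (hc := hc) (hh := hh) (hP := hP)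
  have p8 : 0 ≤ scaleFaceCCertP8 Δ ε₁ d c h m Q G₁ G₂ P := scaleFaceCCertP8_nonneg (hΔ := hΔ.le) (h1 := h1.le) (hd := hd.le) (hc := hc) (hh := hh) (hQ := hQ) (hG₁ := hG₁)
  have p9 : 0 ≤ scaleFaceCCertP9 Δ ε₁ d c h m Q G₁ G₂ P := scaleFaceCCertP9_nonneg (hΔ := hΔ.le) (h1 := h1.le) (hd := hd.le) (hc := hc) (hh := hh) (hm := hm.le) (hQ := hQ) (hG₁ := hG₁)
  have p10 : 0 ≤ scaleFaceCCertP10 Δ ε₁ d c h m Q G₁ G₂ P := scaleFaceCCertP10_nonneg (hΔ := hΔ.le) (h1 := h1.le) (hd := hd.le) (hc := hc) (hh := hh) (hm := hm.le) (hQ := hQ) (hG₁ := hG₁) (hG₂ := hG₂)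
  have p11 : 0 ≤ scaleFaceCCertP11 Δ ε₁ d c h m Q G₁ G₂ P := scaleFaceCCertP11_nonneg (hΔ := hΔ.le) (h1 := h1.le) (hd := hd.le) (hc := hc) (hh := hh) (hm := hm.le) (hQ := hQ) (hG₂ := hG₂)
  have p12 : 0 ≤ scaleFaceCCertP12 Δ ε₁ d c h m Q G₁ G₂ P := scaleFaceCCertP12_nonneg (hΔ := hΔ.le) (h1 := h1.le) (hd := hd.le) (hc := hc) (hh := hh) (hm := hm.le) (hQ := hQ) (hG₂ := hG₂)
  have p13 : 0 ≤ scaleFaceCCertP13 Δ ε₁ d c h m Q G₁ G₂ P := scaleFaceCCertP13_nonneg (hΔ := hΔ.le) (h1 := h1.le) (hd := hd.le) (hc := hc) (hh := hh) (hm := hm.le) (hQ := hQ) (hG₂ := hG₂) (hP := hP)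
  have p14 : 0 ≤ scaleFaceCCertP14 Δ ε₁ d c h m Q G₁ G₂ P := scaleFaceCCertP14_nonneg (hΔ := hΔ.le) (h1 := h1.le) (hd := hd.le) (hc := hc) (hh := hh) (hm := hm.le) (hG₁ := hG₁) (hG₂ := hG₂)
  have p15 : 0 ≤ scaleFaceCCertP15 Δ ε₁ d c h m Q G₁ G₂ P := scaleFaceCCertP15_nonneg (hΔ := hΔ.le) (h1 := h1.le) (hd := hd.le) (hc := hc) (hh := hh) (hm := hm.le) (hG₁ := hG₁) (hG₂ := hG₂)
  have p16 : 0 ≤ scaleFaceCCertP16 Δ ε₁ d c h m Q G₁ G₂ P := scaleFaceCCertP16_nonneg (hΔ := hΔ.le) (h1 := h1.le) (hd := hd.le) (hc := hc) (hh := hh) (hm := hm.le) (hG₁ := hG₁) (hG₂ := hG₂) (hP := hP)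
  have p17 : 0 ≤ scaleFaceCCertP17 Δ ε₁ d c h m Q G₁ G₂ P := scaleFaceCCertP17_nonneg (hΔ := hΔ.le) (h1 := h1.le) (hd := hd.le) (hc := hc) (hh := hh) (hm := hm.le)
  have p18 : 0 ≤ scaleFaceCCertP18 Δ ε₁ d c h m Q G₁ G₂ P := scaleFaceCCertP18_nonneg (hΔ := hΔ.le) (h1 := h1.le) (hd := hd.le) (hc := hc) (hh := hh) (hm := hm.le) (hG₂ := hG₂) (hP := hP)
  have p19 : 0 ≤ scaleFaceCCertP19 Δ ε₁ d c h m Q G₁ G₂ P := scaleFaceCCertP19_nonneg (hΔ := hΔ.le) (h1 := h1.le) (hd := hd.le) (hc := hc) (hh := hh) (hm := hm.le) (hG₂ := hG₂) (hP := hP)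
  have p20 : 0 ≤ scaleFaceCCertP20 Δ ε₁ d c h m Q G₁ G₂ P := scaleFaceCCertP20_nonneg (hΔ := hΔ.le) (h1 := h1.le) (hd := hd.le) (hc := hc) (hh := hh) (hG₂ := hG₂) (hP := hP)
  have p21 : 0 ≤ scaleFaceCCertP21 Δ ε₁ d c h m Q G₁ G₂ P := scaleFaceCCertP21_nonneg (hd := hd.le) (hc := hc) (hh := hh) (hm := hm.le)
  have p22 : 0 ≤ scaleFaceCCertP22 Δ ε₁ d c h m Q G₁ G₂ P := scaleFaceCCertP22_nonneg (hd := hd.le) (hc := hc) (hh := hh) (hm := hm.le)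
  have p23 : 0 ≤ scaleFaceCCertP23 Δ ε₁ d c h m Q G₁ G₂ P := scaleFaceCCertP23_nonneg (hd := hd.le) (hc := hc) (hh := hh) (hm := hm.le)
  have p24 : 0 ≤ scaleFaceCCertP24 Δ ε₁ d c h m Q G₁ G₂ P := scaleFaceCCertP24_nonneg (h1 := h1.le) (hd := hd.le) (hc := hc) (hh := hh) (hm := hm.le)
  have p25 : 0 ≤ scaleFaceCCertP25 Δ ε₁ d c h m Q G₁ G₂ P := scaleFaceCCertP25_nonneg (h1 := h1.le) (hd := hd.le) (hc := hc) (hh := hh) (hm := hm.le)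
  have p26 : 0 ≤ scaleFaceCCertP26 Δ ε₁ d c h m Q G₁ G₂ P := scaleFaceCCertP26_nonneg (h1 := h1.le) (hd := hd.le) (hc := hc) (hh := hh) (hm := hm.le)
  have p27 : 0 ≤ scaleFaceCCertP27 Δ ε₁ d c h m Q G₁ G₂ P := scaleFaceCCertP27_nonneg (h1 := h1.le) (hd := hd.le) (hc := hc) (hh := hh) (hm := hm.le)
  have p28 : 0 ≤ scaleFaceCCertP28 Δ ε₁ d c h m Q G₁ G₂ P := scaleFaceCCertP28_nonneg (hd := hd.le) (hc := hc) (hh := hh) (hm := hm.le)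
  have p29 : 0 ≤ scaleFaceCCertP29 Δ ε₁ d c h m Q G₁ G₂ P := scaleFaceCCertP29_nonneg (hd := hd.le) (hc := hc) (hh := hh) (hm := hm.le)
  have p30 : 0 ≤ scaleFaceCCertP30 Δ ε₁ d c h m Q G₁ G₂ P := scaleFaceCCertP30_nonneg (h1 := h1.le) (hd := hd.le) (hc := hc) (hh := hh) (hm := hm.le)
  have p31 : 0 ≤ scaleFaceCCertP31 Δ ε₁ d c h m Q G₁ G₂ P := scaleFaceCCertP31_nonneg (h1 := h1.le) (hd := hd.le) (hc := hc) (hh := hh) (hm := hm.le)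
  have p32 : 0 ≤ scaleFaceCCertP32 Δ ε₁ d c h m Q G₁ G₂ P := scaleFaceCCertP32_nonneg (h1 := h1.le) (hd := hd.le) (hc := hc) (hh := hh) (hm := hm.le)
  have p33 : 0 ≤ scaleFaceCCertP33 Δ ε₁ d c h m Q G₁ G₂ P := scaleFaceCCertP33_nonneg (hd := hd.le) (hc := hc) (hh := hh) (hm := hm.le)
  have p34 : 0 ≤ scaleFaceCCertP34 Δ ε₁ d c h m Q G₁ G₂ P := scaleFaceCCertP34_nonneg (h1 := h1.le) (hd := hd.le) (hc := hc) (hh := hh) (hm := hm.le)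
  have p35 : 0 ≤ scaleFaceCCertP35 Δ ε₁ d c h m Q G₁ G₂ P := scaleFaceCCertP35_nonneg (h1 := h1.le) (hd := hd.le) (hc := hc) (hh := hh) (hm := hm.le)
  have p36 : 0 ≤ scaleFaceCCertP36 Δ ε₁ d c h m Q G₁ G₂ P := scaleFaceCCertP36_nonneg (hΔ := hΔ.le) (h1 := h1.le) (hd := hd.le) (hc := hc) (hh := hh) (hm := hm.le)
  have p37 : 0 ≤ scaleFaceCCertP37 Δ ε₁ d c h m Q G₁ G₂ P := scaleFaceCCertP37_nonneg (hΔ := hΔ.le) (hd := hd.le) (hc := hc) (hh := hh) (hm := hm.le)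
  have p38 : 0 ≤ scaleFaceCCertP38 Δ ε₁ d c h m Q G₁ G₂ P := scaleFaceCCertP38_nonneg (hΔ := hΔ.le) (hd := hd.le) (hc := hc) (hh := hh) (hm := hm.le)
  have p39 : 0 ≤ scaleFaceCCertP39 Δ ε₁ d c h m Q G₁ G₂ P := scaleFaceCCertP39_nonneg (hΔ := hΔ.le) (hd := hd.le) (hc := hc) (hh := hh) (hm := hm.le)
  have p40 : 0 ≤ scaleFaceCCertP40 Δ ε₁ d c h m Q G₁ G₂ P := scaleFaceCCertP40_nonneg (hΔ := hΔ.le) (h1 := h1.le) (hd := hd.le) (hc := hc) (hh := hh) (hm := hm.le)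
  have p41 : 0 ≤ scaleFaceCCertP41 Δ ε₁ d c h m Q G₁ G₂ P := scaleFaceCCertP41_nonneg (hΔ := hΔ.le) (h1 := h1.le) (hd := hd.le) (hc := hc) (hh := hh) (hm := hm.le)
  have p42 : 0 ≤ scaleFaceCCertP42 Δ ε₁ d c h m Q G₁ G₂ P := scaleFaceCCertP42_nonneg (hΔ := hΔ.le) (h1 := h1.le) (hd := hd.le) (hc := hc) (hh := hh) (hm := hm.le)
  have p43 : 0 ≤ scaleFaceCCertP43 Δ ε₁ d c h m Q G₁ G₂ P := scaleFaceCCertP43_nonneg (hΔ := hΔ.le) (hd := hd.le) (hc := hc) (hh := hh) (hm := hm.le)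
  have p44 : 0 ≤ scaleFaceCCertP44 Δ ε₁ d c h m Q G₁ G₂ P := scaleFaceCCertP44_nonneg (hΔ := hΔ.le) (hd := hd.le) (hc := hc) (hh := hh) (hm := hm.le)
  have p45 : 0 ≤ scaleFaceCCertP45 Δ ε₁ d c h m Q G₁ G₂ P := scaleFaceCCertP45_nonneg (hΔ := hΔ.le) (h1 := h1.le) (hd := hd.le) (hc := hc) (hh := hh) (hm := hm.le)
  have p46 : 0 ≤ scaleFaceCCertP46 Δ ε₁ d c h m Q G₁ G₂ P := scaleFaceCCertP46_nonneg (hΔ := hΔ.le) (h1 := h1.le) (hd := hd.le) (hc := hc) (hh := hh) (hm := hm.le)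
  have p47 : 0 ≤ scaleFaceCCertP47 Δ ε₁ d c h m Q G₁ G₂ P := scaleFaceCCertP47_nonneg (hΔ := hΔ.le) (hd := hd.le) (hc := hc) (hh := hh) (hm := hm.le)
  have p48 : 0 ≤ scaleFaceCCertP48 Δ ε₁ d c h m Q G₁ G₂ P := scaleFaceCCertP48_nonneg (hΔ := hΔ.le) (h1 := h1.le) (hd := hd.le) (hc := hc) (hh := hh) (hm := hm.le)
  have p49 : 0 ≤ scaleFaceCCertP49 Δ ε₁ d c h m Q G₁ G₂ P := scaleFaceCCertP49_nonneg (hΔ := hΔ.le) (h1 := h1.le) (hd := hd.le) (hc := hc) (hh := hh) (hm := hm.le)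
  have p50 : 0 ≤ scaleFaceCCertP50 Δ ε₁ d c h m Q G₁ G₂ P := scaleFaceCCertP50_nonneg (hd := hd.le) (hc := hc) (hh := hh) (hm := hm.le)
  have p51 : 0 ≤ scaleFaceCCertP51 Δ ε₁ d c h m Q G₁ G₂ P := scaleFaceCCertP51_nonneg (hd := hd.le) (hc := hc) (hh := hh) (hm := hm.le)
  have p52 : 0 ≤ scaleFaceCCertP52 Δ ε₁ d c h m Q G₁ G₂ P := scaleFaceCCertP52_nonneg (h1 := h1.le) (hd := hd.le) (hc := hc) (hh := hh) (hm := hm.le)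
  have p53 : 0 ≤ scaleFaceCCertP53 Δ ε₁ d c h m Q G₁ G₂ P := scaleFaceCCertP53_nonneg (h1 := h1.le) (hd := hd.le) (hc := hc) (hh := hh) (hm := hm.le)
  have p54 : 0 ≤ scaleFaceCCertP54 Δ ε₁ d c h m Q G₁ G₂ P := scaleFaceCCertP54_nonneg (h1 := h1.le) (hd := hd.le) (hc := hc) (hh := hh) (hm := hm.le)
  have p55 : 0 ≤ scaleFaceCCertP55 Δ ε₁ d c h m Q G₁ G₂ P := scaleFaceCCertP55_nonneg (h1 := h1.le) (hd := hd.le) (hc := hc) (hh := hh) (hm := hm.le)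
  have p56 : 0 ≤ scaleFaceCCertP56 Δ ε₁ d c h m Q G₁ G₂ P := scaleFaceCCertP56_nonneg (h1 := h1.le) (hd := hd.le) (hc := hc) (hh := hh) (hm := hm.le)
  have p57 : 0 ≤ scaleFaceCCertP57 Δ ε₁ d c h m Q G₁ G₂ P := scaleFaceCCertP57_nonneg (h1 := h1.le) (hd := hd.le) (hc := hc) (hh := hh) (hm := hm.le)
  have p58 : 0 ≤ scaleFaceCCertP58 Δ ε₁ d c h m Q G₁ G₂ P := scaleFaceCCertP58_nonneg (hΔ := hΔ.le) (h1 := h1.le) (hd := hd.le) (hc := hc) (hh := hh) (hm := hm.le)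
  have p59 : 0 ≤ scaleFaceCCertP59 Δ ε₁ d c h m Q G₁ G₂ P := scaleFaceCCertP59_nonneg (hΔ := hΔ.le) (hd := hd.le) (hc := hc) (hh := hh) (hm := hm.le)
  have p60 : 0 ≤ scaleFaceCCertP60 Δ ε₁ d c h m Q G₁ G₂ P := scaleFaceCCertP60_nonneg (hΔ := hΔ.le) (h1 := h1.le) (hd := hd.le) (hc := hc) (hh := hh) (hm := hm.le)
  have p61 : 0 ≤ scaleFaceCCertP61 Δ ε₁ d c h m Q G₁ G₂ P := scaleFaceCCertP61_nonneg (hΔ := hΔ.le) (h1 := h1.le) (hd := hd.le) (hc := hc) (hh := hh) (hm := hm.le)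
  have p62 : 0 ≤ scaleFaceCCertP62 Δ ε₁ d c h m Q G₁ G₂ P := scaleFaceCCertP62_nonneg (hΔ := hΔ.le) (h1 := h1.le) (hd := hd.le) (hc := hc) (hh := hh) (hm := hm.le)
  have p63 : 0 ≤ scaleFaceCCertP63 Δ ε₁ d c h m Q G₁ G₂ P := scaleFaceCCertP63_nonneg (hΔ := hΔ.le) (h1 := h1.le) (hd := hd.le) (hc := hc) (hh := hh) (hm := hm.le)
  have p64 : 0 ≤ scaleFaceCCertP64 Δ ε₁ d c h m Q G₁ G₂ P := scaleFaceCCertP64_nonneg (hΔ := hΔ.le) (h1 := h1.le) (hd := hd.le) (hc := hc) (hh := hh) (hm := hm.le)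
  have p65 : 0 ≤ scaleFaceCCertP65 Δ ε₁ d c h m Q G₁ G₂ P := scaleFaceCCertP65_nonneg (h1 := h1.le) (hd := hd.le) (hc := hc) (hh := hh) (hm := hm.le)
  have p66 : 0 ≤ scaleFaceCCertP66 Δ ε₁ d c h m Q G₁ G₂ P := scaleFaceCCertP66_nonneg (h1 := h1.le) (hd := hd.le) (hc := hc) (hh := hh) (hm := hm.le)
  have p67 : 0 ≤ scaleFaceCCertP67 Δ ε₁ d c h m Q G₁ G₂ P := scaleFaceCCertP67_nonneg (h1 := h1.le) (hd := hd.le) (hc := hc) (hh := hh) (hm := hm.le)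
  have p68 : 0 ≤ scaleFaceCCertP68 Δ ε₁ d c h m Q G₁ G₂ P := scaleFaceCCertP68_nonneg (hΔ := hΔ.le) (h1 := h1.le) (hd := hd.le) (hc := hc) (hh := hh) (hm := hm.le)
  have p69 : 0 ≤ scaleFaceCCertP69 Δ ε₁ d c h m Q G₁ G₂ P := scaleFaceCCertP69_nonneg (hΔ := hΔ.le) (h1 := h1.le) (hd := hd.le) (hc := hc) (hh := hh) (hm := hm.le)
  have p70 : 0 ≤ scaleFaceCCertP70 Δ ε₁ d c h m Q G₁ G₂ P := scaleFaceCCertP70_nonneg (hΔ := hΔ.le) (h1 := h1.le) (hd := hd.le) (hc := hc) (hh := hh) (hm := hm.le)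
  have p71 : 0 ≤ scaleFaceCCertP71 Δ ε₁ d c h m Q G₁ G₂ P := scaleFaceCCertP71_nonneg (h1 := h1.le) (hd := hd.le) (hc := hc) (hh := hh) (hm := hm.le)
  have p72 : 0 ≤ scaleFaceCCertP72 Δ ε₁ d c h m Q G₁ G₂ P := scaleFaceCCertP72_nonneg (hΔ := hΔ.le) (h1 := h1.le) (hd := hd.le) (hc := hc) (hh := hh)
  have hs : 0 < (66867560 : ℝ) * Δ ^ 2 * ε₁ ^ 2 * d ^ 2 * m ^ 2 := by positivity
  unfold scaleFaceCCert
  linarith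

end Summit.Ventures.CertifiedManyBodySolver.Downfold.Emery
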